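import Mathlib
import HarnessLib
import Literature.Probability.MarkovChains.MetropolisHastings

/-!
# The Kennedy–Kuti linear accept/reject step ("noise without noise"): exact with an unbiased
# estimator as long as no probability bound is violated

Topic `Probability/MarkovChains`.  PUBLISHED RESULT with our formalisation of the (elementary)
printed argument; no named fact is introduced.

Sources.  A. D. Kennedy, J. Kuti, *Noise without noise: a new Monte Carlo method*, Phys. Rev.
Lett. 54 (1985) 2473 (the primary; not held — formalised from the two restatements below and cited
with them).  L. Lin, K. F. Liu, J. Sloan, *A noisy Monte Carlo algorithm*, Phys. Rev. D 61 (2000)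
074505 [arXiv:hep-lat/9905033], §1 eq. (1): "The acceptance probability … in Kennedy-Kuti's linear
algorithm is
  `P_a(U₁ → U₂) = λ⁺ + λ⁻ ⟨e^{ΔH}⟩`  if `f(U₁) > f(U₂)`,
  `P_a(U₁ → U₂) = λ⁻ + λ⁺ ⟨e^{ΔH}⟩`  if `f(U₁) ≤ f(U₂)`,
where `λ^±` are tunable real parameters ranging from 0 to 1, `⟨e^{ΔH}⟩` denotes an unbiased
estimator of the transition probability `e^{ΔH}` with `ΔH = H(U₁) − H(U₂)` … `f(U)` is an
observable of the configuration `U` adopted for ordering between `U₁` and `U₂`.  Detailed balance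
can be proven to be satisfied [KK].  But … the probability `P_a` could lie outside the interval
between 0 and 1 since it is estimated stochastically.  Once the probability bound is violated,
detailed balance is lost and systematic bias will show up"; "The choice of `λ⁺ = 0.0, λ⁻ = 1/2` in
ref. [KK] can be generalized to `λ⁺ = 0.0, λ⁻ = 1/(1+α)`".  D. M. Ceperley, M. Dewing, J. Chem.
Phys. 110 (1999) 9812 [arXiv:physics/9812035], §6.1 "Method of Kennedy, Kuti, and Bhanot": an
unbiased estimate `q` of the ratio is obtained and "We finally accept the move with probability
`a = (1+q)/(2+ε)`.  For an appropriate choice of parameters, `a` is in the range `0 ≤ a ≤ 1` most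
of the time"; pseudo-code "if `[(1+q_n)/(2+ε) > prn]` then accept move" (`prn` uniform in
`[0, 1]`); "The advantage of the KKB method is that it makes no assumptions about the normalcy of
the noise; the disadvantage is that one cannot guarantee that `a` is in the range `[0,1]`".

Lean reading.  Finite state space `X`, positive weight `π` (`e^{ΔH} = π U₂ / π U₁` for
`π ∝ e^{−H}`), symmetric proposal matrix `T` (the printed ratio carries no Hastings factor),
ordering observable `f : X → ℝ`, and a finitely-valued estimator: noise `ξ ∈ Ξ` with law `g`
(`Σ g = 1`, `g ≥ 0`) and values `ρ x y ξ`, unbiased: `Σ_ξ g ξ ρ x y ξ = π y / π x`.  Comparing the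
realised value `a` with a uniform `prn` accepts with probability `clip01 a = max 0 (min 1 a)`, so
the chain AS RUN has the noise-averaged off-diagonal rate `T x y · Σ_ξ g ξ · clip01 (P_a(ρ x y ξ))`.

Contents (all proved):
* `kkAccept lp lm f x y ρ` — eq. (1) with the estimate's value `ρ` in place of `⟨e^{ΔH}⟩`;
  `kkAccept_of_eq` — with `λ⁺ = λ⁻ = l` it is `l·(1 + ρ)`, Ceperley–Dewing's `(1+q)/(2+ε)` at
  `l = 1/(2+ε)`;
* `sum_mul_kkAccept` — LINEARITY ("noise without noise"): averaging the rule over an unbiased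
  estimator gives the rule at the exact ratio;
* `mul_kkAccept_symm` — the flux identity `π x · P_a(x → y; π y/π x) = π y · P_a(y → x; π x/π y)`
  behind "Detailed balance can be proven to be satisfied [KK]" (for an injective ordering `f`, or
  for `λ⁺ = λ⁻`);
* `kkRate`, `kkKernel`, `kkRate_eq_of_noViolation` — WITHOUT probability-bound violations
  (`0 ≤ P_a(ρ x y ξ) ≤ 1` for every noise value) the chain as run has rate `T x y · P_a(π y/π x)`;
* `kkKernel_detailedBalance`, `kkKernel_isStationary`, `kkKernel_nonneg` — hence it is a genuine
  transition matrix in detailed balance with `π`: the linear algorithm is EXACT at zero violations.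

The complementary printed sentence — WITH violations "detailed balance is lost and systematic bias
will show up" — is witnessed by an explicit two-state example in the cell file
`Summits/Ventures/LatticeQCDFlow/Exactness/LinearAcceptViolation.lean` (new work, not Literature).

Context (cell pub-lqcd, HOME/R2-SCOPE.md §3 N3): "Kennedy–Kuti LINEAR acceptance with
probability-bound violations ignored … admissible only with a stated violation count of ZERO over
the run (then it is exact [KK])" — the parenthesis is `kkKernel_isStationary` below.
-/

namespace Literature.Probability.MarkovChains

open Finset

/-! ## The linear acceptance rule and its linearity in the estimate -/

section Rule

variable {X : Type*}

/-- Kennedy–Kuti's LINEAR acceptance for the move `x → y`, as a function of the value `ρ` taken by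
the (estimate of the) ratio `e^{ΔH} = π y / π x`: `λ⁺ + λ⁻ρ` if `f x > f y`, `λ⁻ + λ⁺ρ` if
`f x ≤ f y`. [cite: LinLiuSloan2000, §1 eq. (1)]; [cite: KennedyKuti1985, the linear accept/reject
rule (as restated in LinLiuSloan2000 eq. (1))] -/
noncomputable def kkAccept (lp lm : ℝ) (f : X → ℝ) (x y : X) (ρ : ℝ) : ℝ :=
  if f y < f x then lp + lm * ρ else lm + lp * ρ

/-- With equal parameters `λ⁺ = λ⁻ = l` the ordering is immaterial and the rule is `l·(1 + ρ)` —
Ceperley–Dewing's `a = (1 + q)/(2 + ε)` at `l = 1/(2 + ε)`. [cite: CeperleyDewing1999, §6.1 ("We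
finally accept the move with probability a = (1+q)/(2+ε)")] -/
theorem kkAccept_of_eq (l : ℝ) (f : X → ℝ) (x y : X) (ρ : ℝ) :
    kkAccept l l f x y ρ = l * (1 + ρ) := by
  unfold kkAccept
  split_ifs <;> ring

/-- **Linearity ("noise without noise")**: for a noise law `g` with `Σ g = 1`, averaging the linear
rule over the values `ρ ξ` of an estimator gives the rule at the mean `Σ_ξ g ξ ρ ξ` — so an
UNBIASED estimator of `e^{ΔH}` gives, on average, exactly the acceptance at the true ratio.
[cite: LinLiuSloan2000, §1 (eq. (1) with "⟨e^{ΔH}⟩ denotes an unbiased estimator of the transition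
probability e^{ΔH}")]; [cite: KennedyKuti1985, (linear rule, as restated ibid.)] -/
theorem sum_mul_kkAccept {Ξ : Type*} [Fintype Ξ] {g : Ξ → ℝ} (hg : ∑ ξ, g ξ = 1) (lp lm : ℝ)
    (f : X → ℝ) (x y : X) (ρ : Ξ → ℝ) :
    ∑ ξ, g ξ * kkAccept lp lm f x y (ρ ξ) = kkAccept lp lm f x y (∑ ξ, g ξ * ρ ξ) := by
  unfold kkAccept
  split_ifs
  · simp_rw [mul_add, sum_add_distrib, ← sum_mul, hg, one_mul, mul_left_comm _ lm, ← mul_sum]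
  · simp_rw [mul_add, sum_add_distrib, ← sum_mul, hg, one_mul, mul_left_comm _ lp, ← mul_sum]

/-- **The flux identity behind detailed balance**: at the exact ratio,
`π x · P_a(x → y; π y/π x) = π y · P_a(y → x; π x/π y)`, provided the ordering observable separates
states (`f` injective) or `λ⁺ = λ⁻` (then no ordering is needed).  With `f y < f x` both sides equal
`λ⁺ π x + λ⁻ π y`. [cite: LinLiuSloan2000, §1 ("Detailed balance can be proven to be satisfied
[KK]")]; [cite: KennedyKuti1985, (detailed balance of the linear rule)] -/
theorem mul_kkAccept_symm {π : X → ℝ} (hπ : ∀ x, 0 < π x) {lp lm : ℝ} {f : X → ℝ}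
    (hf : lp = lm ∨ Function.Injective f) (x y : X) :
    π x * kkAccept lp lm f x y (π y / π x) = π y * kkAccept lp lm f y x (π x / π y) := by
  have hx : π x ≠ 0 := (hπ x).ne'
  have hy : π y ≠ 0 := (hπ y).ne'
  unfold kkAccept
  by_cases hxy : f y < f x
  · rw [if_pos hxy, if_neg (lt_asymm hxy)]
    field_simp
    ring
  · by_cases hyx : f x < f y
    · rw [if_neg hxy, if_pos hyx]
      field_simp
      ring
    · rw [if_neg hxy, if_neg hyx]
      have hfeq : f x = f y := le_antisymm (not_lt.mp hxy) (not_lt.mp hyx)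
      rcases hf with h | h
      · subst h
        field_simp
        ring
      · rw [h hfeq]

end Rule

/-! ## The chain as run, and its exactness without probability-bound violations -/

section Chain

variable {X Ξ : Type*} [Fintype X] [DecidableEq X] [Fintype Ξ]

/-- Accepting "if `a > prn`" with `prn` uniform on `[0, 1]` accepts with probability
`max 0 (min 1 a)`: the realised value clipped into `[0, 1]`. [cite: CeperleyDewing1999, §6.1
(pseudo-code "if [(1+q_n)/(2+ε) > prn] then accept move")] -/
noncomputable def clip01 (a : ℝ) : ℝ := max 0 (min 1 a)

omit [Fintype X] [DecidableEq X] [Fintype Ξ] in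
/-- Inside the probability bounds the clip does nothing. [cite: LinLiuSloan2000, §1 ("The
probability P_a could lie outside the interval between 0 and 1")] -/
theorem clip01_of_mem {a : ℝ} (h0 : 0 ≤ a) (h1 : a ≤ 1) : clip01 a = a := by
  rw [clip01, min_eq_right h1, max_eq_right h0]

omit [Fintype X] [DecidableEq X] [Fintype Ξ] in
/-- The clipped value is a probability. [cite: CeperleyDewing1999, §6.1] -/
theorem clip01_nonneg (a : ℝ) : 0 ≤ clip01 a := le_max_left _ _

omit [Fintype X] [DecidableEq X] [Fintype Ξ] in
/-- The clipped value is a probability. [cite: CeperleyDewing1999, §6.1] -/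
theorem clip01_le_one (a : ℝ) : clip01 a ≤ 1 := max_le zero_le_one (min_le_left _ _)

/-- Off-diagonal rate of the linear algorithm AS RUN: propose `y` with probability `T x y`, draw the
estimator's noise `ξ ∼ g`, accept if the realised `P_a(ρ x y ξ)` exceeds a uniform random number;
averaged over the noise: `T x y · Σ_ξ g ξ · clip01 (P_a(ρ x y ξ))`. [cite: LinLiuSloan2000, §1
eq. (1)]; [cite: CeperleyDewing1999, §6.1 (pseudo-code)] -/
noncomputable def kkRate (T : X → X → ℝ) (lp lm : ℝ) (f : X → ℝ) (g : Ξ → ℝ) (ρ : X → X → Ξ → ℝ)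
    (x y : X) : ℝ :=
  T x y * ∑ ξ, g ξ * clip01 (kkAccept lp lm f x y (ρ x y ξ))

/-- The linear algorithm's transition matrix on states: off the diagonal `kkRate`, the rejected mass
on the diagonal. [cite: LinLiuSloan2000, §1]; [cite: CeperleyDewing1999, §6.1] -/
noncomputable def kkKernel (T : X → X → ℝ) (lp lm : ℝ) (f : X → ℝ) (g : Ξ → ℝ)
    (ρ : X → X → Ξ → ℝ) (x y : X) : ℝ :=
  if y = x then 1 - ∑ z ∈ univ.erase x, kkRate T lp lm f g ρ x z else kkRate T lp lm f g ρ x y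

/-- Off-diagonal entries of the kernel are the rates. [cite: LinLiuSloan2000, §1 eq. (1)] -/
theorem kkKernel_of_ne (T : X → X → ℝ) (lp lm : ℝ) (f : X → ℝ) (g : Ξ → ℝ) (ρ : X → X → Ξ → ℝ)
    {x y : X} (h : y ≠ x) : kkKernel T lp lm f g ρ x y = kkRate T lp lm f g ρ x y := if_neg h

/-- Diagonal entry of the kernel: rejected moves keep the state. [cite: CeperleyDewing1999, §6.1
(pseudo-code: "reject move")] -/
theorem kkKernel_self (T : X → X → ℝ) (lp lm : ℝ) (f : X → ℝ) (g : Ξ → ℝ) (ρ : X → X → Ξ → ℝ)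
    (x : X) : kkKernel T lp lm f g ρ x x = 1 - ∑ z ∈ univ.erase x, kkRate T lp lm f g ρ x z :=
  if_pos rfl

/-- Rows of the kernel sum to one. [cite: CeperleyDewing1999, §6.1] -/
theorem kkKernel_sum_eq_one (T : X → X → ℝ) (lp lm : ℝ) (f : X → ℝ) (g : Ξ → ℝ)
    (ρ : X → X → Ξ → ℝ) (x : X) : ∑ y, kkKernel T lp lm f g ρ x y = 1 := by
  rw [← add_sum_erase _ _ (mem_univ x), kkKernel_self]
  have : ∑ y ∈ univ.erase x, kkKernel T lp lm f g ρ x y =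
      ∑ y ∈ univ.erase x, kkRate T lp lm f g ρ x y :=
    sum_congr rfl fun y hy => kkKernel_of_ne T lp lm f g ρ (ne_of_mem_erase hy)
  rw [this]
  ring

omit [Fintype X] [DecidableEq X] in
/-- The rate is at most the proposal probability (for `T ≥ 0`, `g ≥ 0`, `Σ g = 1`).
[cite: CeperleyDewing1999, §6.1] -/
theorem kkRate_le {T : X → X → ℝ} (hT : ∀ x y, 0 ≤ T x y) {g : Ξ → ℝ} (hg0 : ∀ ξ, 0 ≤ g ξ)
    (hg : ∑ ξ, g ξ = 1) (lp lm : ℝ) (f : X → ℝ) (ρ : X → X → Ξ → ℝ) (x y : X) :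
    kkRate T lp lm f g ρ x y ≤ T x y := by
  unfold kkRate
  refine mul_le_of_le_one_right (hT x y) ?_
  calc ∑ ξ, g ξ * clip01 (kkAccept lp lm f x y (ρ x y ξ)) ≤ ∑ ξ, g ξ :=
        sum_le_sum fun ξ _ => mul_le_of_le_one_right (hg0 ξ) (clip01_le_one _)
    _ = 1 := hg

omit [Fintype X] [DecidableEq X] in
/-- The rate is non-negative (for `T ≥ 0`, `g ≥ 0`). [cite: CeperleyDewing1999, §6.1] -/
theorem kkRate_nonneg {T : X → X → ℝ} (hT : ∀ x y, 0 ≤ T x y) {g : Ξ → ℝ} (hg0 : ∀ ξ, 0 ≤ g ξ)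
    (lp lm : ℝ) (f : X → ℝ) (ρ : X → X → Ξ → ℝ) (x y : X) : 0 ≤ kkRate T lp lm f g ρ x y :=
  mul_nonneg (hT x y) (sum_nonneg fun ξ _ => mul_nonneg (hg0 ξ) (clip01_nonneg _))

/-- The kernel of the linear algorithm as run is entrywise non-negative whenever `T ≥ 0` has row sums
`≤ 1` and `g` is a probability vector — whatever the estimator does. [cite: CeperleyDewing1999,
§6.1] -/
theorem kkKernel_nonneg {T : X → X → ℝ} (hT : ∀ x y, 0 ≤ T x y) (hTrow : ∀ x, ∑ y, T x y ≤ 1)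
    {g : Ξ → ℝ} (hg0 : ∀ ξ, 0 ≤ g ξ) (hg : ∑ ξ, g ξ = 1) (lp lm : ℝ) (f : X → ℝ)
    (ρ : X → X → Ξ → ℝ) (x y : X) : 0 ≤ kkKernel T lp lm f g ρ x y := by
  by_cases h : y = x
  · subst h
    rw [kkKernel_self, sub_nonneg]
    calc ∑ z ∈ univ.erase y, kkRate T lp lm f g ρ y z ≤ ∑ z ∈ univ.erase y, T y z :=
          sum_le_sum fun z _ => kkRate_le hT hg0 hg lp lm f ρ y z
      _ ≤ ∑ z, T y z := sum_le_sum_of_subset_of_nonneg (erase_subset _ _) fun z _ _ => hT y z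
      _ ≤ 1 := hTrow y
  · rw [kkKernel_of_ne T lp lm f g ρ h]
    exact kkRate_nonneg hT hg0 lp lm f ρ x y

omit [Fintype X] [DecidableEq X] in
/-- **No violation ⇒ "noise without noise"**: if every realised acceptance value of the move `x → y`
lies in `[0, 1]` and the estimator is unbiased for a value `r`, the chain as run moves `x → y` at
the rate `T x y · P_a(r)` of the rule evaluated AT THE EXACT RATIO. [cite: LinLiuSloan2000, §1
(eq. (1); "as long as they are unbiased")]; [cite: KennedyKuti1985, (linear rule)] -/
theorem kkRate_eq_of_noViolation {T : X → X → ℝ} {lp lm : ℝ} {f : X → ℝ} {g : Ξ → ℝ}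
    (hg : ∑ ξ, g ξ = 1) {ρ : X → X → Ξ → ℝ} {x y : X} {r : ℝ} (hρ : ∑ ξ, g ξ * ρ x y ξ = r)
    (hb : ∀ ξ, 0 ≤ kkAccept lp lm f x y (ρ x y ξ) ∧ kkAccept lp lm f x y (ρ x y ξ) ≤ 1) :
    kkRate T lp lm f g ρ x y = T x y * kkAccept lp lm f x y r := by
  unfold kkRate
  congr 1
  rw [← hρ, ← sum_mul_kkAccept hg]
  exact sum_congr rfl fun ξ _ => by rw [clip01_of_mem (hb ξ).1 (hb ξ).2]

/-- **Kennedy–Kuti: the linear algorithm is exact when no probability bound is violated.**  For a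
positive weight `π`, a SYMMETRIC proposal matrix `T`, an ordering observable that separates states
(or `λ⁺ = λ⁻`), a noise law `g` with `Σ g = 1` and an estimator unbiased for the ratio
(`Σ_ξ g ξ ρ x y ξ = π y / π x`), if every realised acceptance value lies in `[0, 1]` then the chain
as run is in detailed balance with `π`. [cite: LinLiuSloan2000, §1 ("Detailed balance can be proven
to be satisfied [KK] … Once the probability bound is violated, detailed balance is lost")];
[cite: KennedyKuti1985, (detailed balance of the linear algorithm)] -/
theorem kkKernel_detailedBalance {π : X → ℝ} (hπ : ∀ x, 0 < π x) {T : X → X → ℝ}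
    (hT : ∀ x y, T x y = T y x) {lp lm : ℝ} {f : X → ℝ} (hf : lp = lm ∨ Function.Injective f)
    {g : Ξ → ℝ} (hg : ∑ ξ, g ξ = 1) {ρ : X → X → Ξ → ℝ}
    (hρ : ∀ x y, ∑ ξ, g ξ * ρ x y ξ = π y / π x)
    (hb : ∀ x y ξ, 0 ≤ kkAccept lp lm f x y (ρ x y ξ) ∧ kkAccept lp lm f x y (ρ x y ξ) ≤ 1) :
    DetailedBalance π (kkKernel T lp lm f g ρ) := by
  intro x y
  by_cases h : y = x
  · subst h; rfl
  rw [kkKernel_of_ne T lp lm f g ρ h, kkKernel_of_ne T lp lm f g ρ (Ne.symm h),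
    kkRate_eq_of_noViolation hg (hρ x y) (hb x y), kkRate_eq_of_noViolation hg (hρ y x) (hb y x),
    mul_left_comm, mul_kkAccept_symm hπ hf x y, hT x y, mul_left_comm]

/-- **Stationarity**: under the same hypotheses `π` is stationary for the linear algorithm as run —
with zero probability-bound violations the Kennedy–Kuti chain samples `π` exactly, for ANY noise
distribution of the unbiased estimator ("it makes no assumptions about the normalcy of the noise").
[cite: LinLiuSloan2000, §1]; [cite: CeperleyDewing1999, §6.1]; [cite: KennedyKuti1985, (main
result)] -/
theorem kkKernel_isStationary {π : X → ℝ} (hπ : ∀ x, 0 < π x) {T : X → X → ℝ}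
    (hT : ∀ x y, T x y = T y x) {lp lm : ℝ} {f : X → ℝ} (hf : lp = lm ∨ Function.Injective f)
    {g : Ξ → ℝ} (hg : ∑ ξ, g ξ = 1) {ρ : X → X → Ξ → ℝ}
    (hρ : ∀ x y, ∑ ξ, g ξ * ρ x y ξ = π y / π x)
    (hb : ∀ x y ξ, 0 ≤ kkAccept lp lm f x y (ρ x y ξ) ∧ kkAccept lp lm f x y (ρ x y ξ) ≤ 1) :
    IsStationary π (kkKernel T lp lm f g ρ) :=
  (kkKernel_detailedBalance hπ hT hf hg hρ hb).isStationary (kkKernel_sum_eq_one T lp lm f g ρ)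

end Chain

end Literature.Probability.MarkovChains
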